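import Summits.HodgeConjecture.HodgeConjecture.Theorems.NoetherLefschetzOneUpLevelZeroNets
import Literature.AlgebraicGeometry.Motives.FiberNetExistence
import HarnessLib

/-!
# Route NoetherLefschetzOneUp — crux `K3TypeNets` (stmt-HodgeConjecture-11600), stub S1 `stub_netStructure`:
# a K3-type fibration of a fourfold over `ℙ²` is a surface net

Stub `stub_netStructure` (S1) of line `registered` of the crux `K3TypeNets`
(`Cruxes/K3TypeNets/Lines/birth.lean`): for `X` smooth projective of dimension `4` over `ℂ`,
`f : X ⟶ ℙ²_ℂ` surjective on points, with smooth projective (geometrically irreducible) surface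
fibres `fiberOver f s` over the `ℂ`-points `s` off a proper Zariski-closed `T ⊊ ℙ²`,

* `f` has GEOMETRICALLY CONNECTED fibres over every point of `ℙ²` — Zariski's connectedness theorem
  / Stein factorisation over the normal base `ℙ²_ℂ` (Stacks 0AY8, Hartshorne III Cor. 11.3 and
  Cor. 11.5), in the tree `LevelZeroNetsStein.geometricallyConnected_of_isPreconnected_fibres`
  (PROVED): `ℙ²_ℂ` is integral and normal (`LevelZeroNetsStein.isIntegrallyClosed_stalk_of_isSmoothProjective`),
  `X` is integral, `f` is proper (as `X → Spec ℂ` is proper and `ℙ² → Spec ℂ` separated), and the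
  point-fibre over a closed point `s ∉ T` is preconnected, being the image of the irreducible
  `X ×_{ℙ²} Spec ℂ = fiberOver f s` (closed points of `ℙ²_ℂ` are `ℂ`-points,
  `ComplexPoints.equivClosedPoints`; `Scheme.Pullback.range_fst`);
* wherever `f` is smooth it is smooth of RELATIVE DIMENSION `2` (Hartshorne III Prop. 10.4 —
  relative dimensions add up along `X → ℙ² → Spec ℂ`), in the tree
  `Motives.smoothOfRelativeDimension_morphismRestrict_of_isSmoothProjective` (PROVED) at
  `m = r = 2`.

These are exactly the two extra fields of `Motives.SurfaceNet.ofFibration`; the composition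
`K3TypeNets_of` of the line calls this stub first and builds the tautological surface net from it.

Result: `stub_netStructure` (sorry-free, standard axioms), VERBATIM the registered signature.
-/

-- `Summit.HodgeConjecture.HodgeConjecture.Theorems` is the mandated namespace (single-problem summit),
-- flagged by `linter.dupNamespace`; the lakefile turns the linter off tree-wide, restated here.
set_option linter.dupNamespace false

noncomputable section

open CategoryTheory AlgebraicGeometry Limits
open Literature.AlgebraicGeometry.Motives Literature.AlgebraicGeometry.HodgeTheory

namespace Summit.HodgeConjecture.HodgeConjecture.Theorems

namespace K3TypeNetsStein

/-- **The fibre over a closed point off `T` is preconnected** (variant of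
`LevelZeroNetsStein.isPreconnected_fibre_of_isSmoothProjective_fiberOver` with the bare fibre
hypothesis, no Hodge-number conjunct). For `f : X ⟶ ℙ²` whose fibres `fiberOver f s` over the
complex points `s` off `T` are smooth projective (geometrically irreducible), the point-fibre
`f⁻¹{s}` over every closed point `s ∉ T` of `ℙ²` is preconnected: closed points of `ℙ²_ℂ` are
complex points (Nullstellensatz, `ComplexPoints.equivClosedPoints`), and `f⁻¹{s.pt}` is the image of
the irreducible scheme `X ×_{ℙ²} Spec ℂ` (`Scheme.Pullback.range_fst`).
[cite: Hartshorne1977, III Cor. 11.3 and Cor. 11.5] -/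
theorem isPreconnected_fibre_of_isSmoothProjective_fiberOver {X : SchemeOver ℂ}
    (f : X ⟶ projectiveSpace 2 ℂ) {T : Set (projectiveSpace 2 ℂ).left}
    (hgen : ∀ s : AlgPoints (projectiveSpace 2 ℂ) ℂ, s.pt ∉ T → IsSmoothProjective 2 (fiberOver f s))
    (s : (projectiveSpace 2 ℂ).left) (hs : IsClosed ({s} : Set (projectiveSpace 2 ℂ).left))
    (hsT : s ∉ T) : _root_.IsPreconnected (f.left ⁻¹' {s}) := by
  -- adapted from `LevelZeroNetsStein.isPreconnected_fibre_of_isSmoothProjective_fiberOver`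
  have hP := isSmoothProjective_projectiveSpace_holds ℂ 2
  haveI := hP.smoothOfRelativeDimension
  haveI : Smooth (projectiveSpace 2 ℂ).hom := SmoothOfRelativeDimension.smooth 2 _
  set s' : AlgPoints (projectiveSpace 2 ℂ) ℂ :=
    (ComplexPoints.equivClosedPoints (projectiveSpace 2 ℂ)).symm ⟨s, hs⟩ with hs'
  have hpt : s'.pt = s := by
    rw [← ComplexPoints.coe_equivClosedPoints_apply, hs', Equiv.apply_symm_apply]
  have hF := hgen s' (hpt ▸ hsT)
  haveI : IrreducibleSpace ↥(pullback f.left s'.left) := irreducibleSpace_of_isSmoothProjective' hF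
  have hr : Set.range s'.toSpecHom = {s'.pt} :=
    Set.range_eq_singleton fun x ↦ by
      change s'.toSpecHom x = s'.toSpecHom (IsLocalRing.closedPoint ℂ)
      rw [Subsingleton.elim x (IsLocalRing.closedPoint ℂ)]
  have hrange : Set.range (pullback.fst f.left s'.left) = f.left ⁻¹' {s} := by
    rw [Scheme.Pullback.range_fst, ← hpt]
    change f.left ⁻¹' Set.range s'.toSpecHom = _
    rw [hr]
  rw [← hrange]
  exact isPreconnected_range (pullback.fst f.left s'.left).continuous

/-- **All fibres of a net with smooth general fibres are geometrically connected.** For a smooth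
projective complex fourfold `X` and a surjective `f : X ⟶ ℙ²` whose fibres over the complex points
off a proper Zariski-closed `T ⊆ ℙ²` are smooth projective surfaces, `f` has geometrically
connected fibres over every point of `ℙ²` (Stein factorisation / Zariski's connectedness theorem:
`LevelZeroNetsStein.geometricallyConnected_of_isPreconnected_fibres` with `S = ℙ²_ℂ`, which is
integral and normal, `X` integral, `f` proper as `X` is proper and `ℙ²` separated over `ℂ`).
[cite: StacksProject, Tag 0AY8] [cite: Hartshorne1977, III Cor. 11.3 and Cor. 11.5] -/
theorem geometricallyConnected_of_net {X : SchemeOver ℂ} (f : X ⟶ projectiveSpace 2 ℂ)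
    (hX : IsSmoothProjective 4 X) (hf : Function.Surjective f.left.base)
    (hgen : ∃ T : Set (projectiveSpace 2 ℂ).left, IsClosed T ∧ T ≠ Set.univ ∧
      ∀ s : AlgPoints (projectiveSpace 2 ℂ) ℂ, s.pt ∉ T → IsSmoothProjective 2 (fiberOver f s)) :
    GeometricallyConnected f.left := by
  -- adapted from `LevelZeroNetsStein.geometricallyConnected_of_net`
  obtain ⟨T, hT, hTne, hgen⟩ := hgen
  have hP := isSmoothProjective_projectiveSpace_holds ℂ 2
  haveI : IsIntegral X.left := IsSmoothProjective.isIntegral_holds hX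
  haveI : IsIntegral (projectiveSpace 2 ℂ).left := IsSmoothProjective.isIntegral_holds hP
  haveI : IsProper X.hom := IsSmoothProjective.isProper_holds hX
  haveI : IsProper (projectiveSpace 2 ℂ).hom := IsSmoothProjective.isProper_holds hP
  haveI : IsProper f.left := by
    have : IsProper (f.left ≫ (projectiveSpace 2 ℂ).hom) := by rw [Over.w f]; infer_instance
    exact IsProper.of_comp f.left (projectiveSpace 2 ℂ).hom
  haveI : Surjective f.left := ⟨hf⟩
  exact LevelZeroNetsStein.geometricallyConnected_of_isPreconnected_fibres f.left
    (projectiveSpace 2 ℂ).hom (LevelZeroNetsStein.isIntegrallyClosed_stalk_of_isSmoothProjective hP)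
    hT hTne (isPreconnected_fibre_of_isSmoothProjective_fiberOver f hgen)

end K3TypeNetsStein

/-- **Stub S1 — a K3-type fibration of a fourfold over `ℙ²` is a surface net** (crux `K3TypeNets`,
stmt-HodgeConjecture-11600, line `registered`; VERBATIM the registered signature). For `X` smooth
projective of dimension `4`, `f : X ⟶ ℙ²_ℂ` surjective on points, with smooth projective
(geometrically irreducible) surface fibres over the `ℂ`-points off a proper closed `T`: `f` has
geometrically connected fibres (Stein factorisation over the normal base `ℙ²`; Zariski's
connectedness theorem — `K3TypeNetsStein.geometricallyConnected_of_net`), and wherever `f` is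
smooth it is smooth of relative dimension `2` (relative dimensions add up along `X → ℙ² → Spec ℂ`,
`Motives.smoothOfRelativeDimension_morphismRestrict_of_isSmoothProjective` at `m = r = 2`).
Exactly the two extra fields of `Motives.SurfaceNet.ofFibration`.
[cite: StacksProject, Tag 0AY8] [cite: Hartshorne1977, III Cor. 11.3 and Cor. 11.5, III Prop. 10.4] -/
theorem stub_netStructure :
    ∀ ⦃X : SchemeOver ℂ⦄ (f : X ⟶ projectiveSpace 2 ℂ), IsSmoothProjective 4 X →
      Function.Surjective f.left.base →
      (∃ T : Set (projectiveSpace 2 ℂ).left, IsClosed T ∧ T ≠ Set.univ ∧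
        ∀ s : AlgPoints (projectiveSpace 2 ℂ) ℂ, s.pt ∉ T → IsSmoothProjective 2 (fiberOver f s)) →
      GeometricallyConnected f.left ∧
        ∀ U : (projectiveSpace 2 ℂ).left.Opens,
          Smooth (f.left ∣_ U) → SmoothOfRelativeDimension 2 (f.left ∣_ U) := by
  intro X f hX hf hgen
  exact ⟨K3TypeNetsStein.geometricallyConnected_of_net f hX hf hgen, fun U hU ↦
    smoothOfRelativeDimension_morphismRestrict_of_isSmoothProjective (m := 2) (r := 2) hX f U hU⟩

end Summit.HodgeConjecture.HodgeConjecture.Theorems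

end
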